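import Mathlib

/-!
# The calculus constants of the polar trapping lemma (K25)

Solo seat `solo-NavierStokesRegularity-informed`, session 13; companion of
`paper/axisymmetric-rigidity.md` §5b, Lemma 8.12 (polar trapping for the swirling-cone germ). The lemma is an
explicit bootstrap on `(0, φ*]`; its numerical constants come from three calculus facts, certified here:

* `polarTrap_sin_lower`: `0.95 φ ≤ sin φ` on `[0, 1/2]` (from Mathlib's `Real.sin_bound`), whence
  `∫ dφ'/sin φ' ≤ 1.053 log(φ*/φ)`;
* `polarTrap_moment_one`, `polarTrap_moment_two`: antiderivatives of `t log(a/t)` and `t log(a/t)²` on `t > 0`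
  (`t²/2·ℓ + t²/4` and `t²/2·ℓ² + t²/2·ℓ + t²/4`, `ℓ = log a - log t = log(a/t)`), giving the moments
  `∫₀^a t ℓ = ∫₀^a t ℓ² = a²/4` used in the bootstrap;
* `polarTrap_conclusion`: the final step — a flux enclosure `|V₀ - V*| ≤ Δ < |V*|/2` with `V* < 0` forces
  `M₀ = V₀/3 ≤ -|V*|/6 < 0`.
No new definitions; axioms: standard.
-/

namespace Summit.NavierStokesRegularity.NavierStokesRegularity.Theorems

/-- On `[0, 1/2]`, `sin φ ≥ 0.95 φ` (Taylor bound `|sin x - (x - x³/6)| ≤ (5/96)|x|⁴`). -/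
theorem polarTrap_sin_lower {x : ℝ} (h0 : 0 ≤ x) (h1 : x ≤ 1 / 2) :
    0.95 * x ≤ Real.sin x := by
  have hb := Real.sin_bound (show |x| ≤ 1 by rw [abs_of_nonneg h0]; linarith)
  rw [abs_of_nonneg h0] at hb
  have h2 := (abs_le.mp hb).1
  have hx4 : x ^ 4 ≤ x * (1 / 8) := by nlinarith [pow_le_pow_left₀ h0 h1 3]
  have hx3 : x ^ 3 ≤ x * (1 / 4) := by nlinarith [pow_le_pow_left₀ h0 h1 2]
  nlinarith

/-- Antiderivative of `t ↦ t · ℓ` on `t > 0`, `ℓ = log a - log t` (`= log (a/t)`): `F(t) = t²/2 · ℓ + t²/4`. -/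
theorem polarTrap_moment_one (a : ℝ) {t : ℝ} (ht : 0 < t) :
    HasDerivAt (fun t => t ^ 2 / 2 * (Real.log a - Real.log t) + t ^ 2 / 4)
      (t * (Real.log a - Real.log t)) t := by
  have ht' : t ≠ 0 := ht.ne'
  have hl : HasDerivAt (fun t => Real.log a - Real.log t) (-t⁻¹) t :=
    (Real.hasDerivAt_log ht').const_sub _
  have hp := (hasDerivAt_pow 2 t).div_const 2
  have hq := (hasDerivAt_pow 2 t).div_const 4
  have h := (hp.mul hl).add hq
  refine h.congr_deriv ?_
  norm_num
  field_simp
  ring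

/-- Antiderivative of `t ↦ t · ℓ²` on `t > 0`, `ℓ = log a - log t`: `F(t) = t²/2 · ℓ² + t²/2 · ℓ + t²/4`. -/
theorem polarTrap_moment_two (a : ℝ) {t : ℝ} (ht : 0 < t) :
    HasDerivAt (fun t => t ^ 2 / 2 * ((Real.log a - Real.log t) * (Real.log a - Real.log t))
        + t ^ 2 / 2 * (Real.log a - Real.log t) + t ^ 2 / 4)
      (t * (Real.log a - Real.log t) ^ 2) t := by
  have ht' : t ≠ 0 := ht.ne'
  have hl : HasDerivAt (fun t => Real.log a - Real.log t) (-t⁻¹) t :=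
    (Real.hasDerivAt_log ht').const_sub _
  have hp := (hasDerivAt_pow 2 t).div_const 2
  have hq := (hasDerivAt_pow 2 t).div_const 4
  have h := ((hp.mul (hl.mul hl)).add (hp.mul hl)).add hq
  refine h.congr_deriv ?_
  norm_num
  field_simp
  ring

/-- The conclusion of the trapping lemma: an enclosure of the limiting flux `V₀ = lim v sin φ` within `Δ < |V*|/2`
of the (negative) flux `V*` at `φ*` gives `M₀ = V₀/3 ≤ -|V*|/6 < 0`. -/
theorem polarTrap_conclusion {Vstar V0 Δ : ℝ} (hneg : Vstar < 0) (henc : |V0 - Vstar| ≤ Δ)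
    (hΔ : Δ < |Vstar| / 2) : V0 / 3 ≤ -|Vstar| / 6 ∧ V0 / 3 < 0 := by
  rw [abs_of_neg hneg] at hΔ
  have h1 := (abs_le.mp henc).2
  constructor
  · rw [abs_of_neg hneg]; linarith
  · linarith

end Summit.NavierStokesRegularity.NavierStokesRegularity.Theorems
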